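import Summits.QuantumFields.YangMills.Theorems.ColdStartUniversalityLatticeLangevinErgodicAverageEveryRealisation
import HarnessLib

/-!
# Route `ColdStartUniversality` (fixed-cut-off SZZ dynamics): ★★★ THE ALMOST-SURE ERGODIC THEOREM FOR THE COLD-START LANGEVIN SAMPLER —
# `T⁻¹ ∫₀ᵀ G(U_r) dr → ∫ G dμ_(β')` almost surely, every coupling, every start, every bounded measurable `G`, every realisation

Helper file (seat `ym-line-csu-p1`, g33; `--supports stmt-QuantumFields-24809`).  From the mean-square ergodic theorem (files 49/51:
`E[(T⁻¹∫₀ᵀ G(U_r)dr − μG)²] ≤ 4C/(cT)`) by the classical route: summability of the variances along `T_n = n²`, Borel–Cantelli in the form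
`E Σ < ∞ ⇒ Σ < ∞ a.s.`, and deterministic interpolation between consecutive squares (the integrand is bounded):
* ★★ `ae_tendsto_timeAverage_zero_of_sq_le` — generic: a jointly measurable bounded random field `g` on `ℝ × Ω` with
  `E[(T⁻¹∫_(0,T] g)²] ≤ K/T` for all `T > 0` has `T⁻¹∫_(0,T] g(r,ω) dr → 0` for a.e. `ω`;
* ★★★ `ae_tendsto_timeAverage_wilson` — for EVERY strong solution `U` of the SU(2) SZZ dynamics from a deterministic start on ANY probability space
  and every bounded measurable `G`: `T⁻¹ ∫_(0,T] G(U_r) dr → ∫ G dμ_(β')` ALMOST SURELY (every coupling) — the pathwise ergodic theorem for the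
  cold-start Langevin simulation: a single run computes Gibbs expectations.
THEOREMS ONLY, no definition, no sorry; [folklore].  HONEST FRAMING: fixed cut-off, every coupling (rates from Harris constants, volume-dependent);
`UniformColdStartMixing` (24809) is NOT restated; no crux, rung or summit statement is proved; the Yang–Mills mass gap is NOT proved.
-/

set_option autoImplicit false

noncomputable section

namespace Summit.QuantumFields.YangMills.Theorems.ColdStartUniversality.LiebRobinson

open MeasureTheory ProbabilityTheory Matrix Complex Finset Filter Set Metric
open scoped ComplexConjugate BigOperators Matrix NNReal ENNReal Topology
open Literature.Probability.Process Literature.MathematicalPhysics.QuantumFieldTheory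
open Literature.MathematicalPhysics.QuantumFieldTheory.Balaban1983to89
open Literature.MathematicalPhysics.QuantumLattice (fundamentalRep fundamentalLatticeRep continuous_fundamentalRep fundamentalRep_apply)

/-! ## §1. Generic: mean-square rate `K/T` + bounded integrand ⇒ almost-sure convergence of time averages -/

/-- ★★ **Almost-sure convergence of time averages from a mean-square rate.**  Let `g : ℝ → Ω → ℝ` be jointly measurable with `|g| ≤ B` and
`E[(T⁻¹ ∫_(0,T] g(r) dr)²] ≤ K/T` for every `T > 0`.  Then `T⁻¹ ∫_(0,T] g(r, ω) dr → 0` for almost every `ω`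
(variances summable along `T_n = (n+1)²`; `E Σ < ∞ ⇒ Σ < ∞` a.s.; interpolation `|∫_(m²,T] g| ≤ B(2m+1)` for `m² ≤ T < (m+1)²`). [folklore] -/
theorem ae_tendsto_timeAverage_zero_of_sq_le {Ω : Type*} [MeasurableSpace Ω] {P : Measure Ω} [IsProbabilityMeasure P]
    {g : ℝ → Ω → ℝ} (hg : Measurable (Function.uncurry g)) {B : ℝ} (hB : ∀ r ω, |g r ω| ≤ B)
    {K : ℝ} (hvar : ∀ T : ℝ, 0 < T → ∫ ω, (T⁻¹ * ∫ r in Ioc 0 T, g r ω) ^ 2 ∂P ≤ K / T) :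
    ∀ᵐ ω ∂P, Tendsto (fun T : ℝ => T⁻¹ * ∫ r in Ioc 0 T, g r ω) atTop (𝓝 0) := by
  -- measurability of the time integrals in `ω`
  have hgr : ∀ ω, Measurable fun r => g r ω := fun ω => hg.comp (measurable_id.prodMk measurable_const)
  have hA : ∀ T : ℝ, Measurable fun ω => ∫ r in Ioc 0 T, g r ω := by
    intro T
    have h1 : StronglyMeasurable (Function.uncurry fun (ω : Ω) (r : ℝ) => g r ω) := (hg.comp measurable_swap).stronglyMeasurable
    exact (h1.integral_prod_right (ν := volume.restrict (Ioc 0 T))).measurable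
  have hAb : ∀ {S : Set ℝ} (ω : Ω), volume S < ∞ → |∫ r in S, g r ω| ≤ B * volume.real S := fun {S} ω hS => by
    have h := norm_setIntegral_le_of_norm_le_const hS (fun r _ => show ‖g r ω‖ ≤ B by rw [Real.norm_eq_abs]; exact hB r ω) (f := fun r => g r ω)
    simpa [Real.norm_eq_abs] using h
  have hK0 : 0 ≤ K := by
    have h := hvar 1 one_pos
    rw [div_one] at h
    exact le_trans (integral_nonneg fun ω => sq_nonneg _) h
  -- the squares `T_n = (n+1)²` and `X n = (T_n⁻¹ ∫_(0,T_n] g)²`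
  set X : ℕ → Ω → ℝ := fun n ω => ((((n : ℝ) + 1) ^ 2)⁻¹ * ∫ r in Ioc 0 (((n : ℝ) + 1) ^ 2), g r ω) ^ 2 with hX
  have hXm : ∀ n, Measurable (X n) := fun n => ((hA _).const_mul _).pow_const 2
  have hX0 : ∀ n ω, 0 ≤ X n ω := fun n ω => sq_nonneg _
  have hTn : ∀ n : ℕ, (0 : ℝ) < ((n : ℝ) + 1) ^ 2 := fun n => by positivity
  have hXb : ∀ n ω, X n ω ≤ B ^ 2 := by
    intro n ω
    have h1 := hAb (S := Ioc 0 (((n : ℝ) + 1) ^ 2)) ω measure_Ioc_lt_top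
    rw [Real.volume_real_Ioc_of_le (hTn n).le, sub_zero] at h1
    have h2 : |(((n : ℝ) + 1) ^ 2)⁻¹ * ∫ r in Ioc 0 (((n : ℝ) + 1) ^ 2), g r ω| ≤ B := by
      rw [abs_mul, abs_inv, abs_of_pos (hTn n)]
      calc (((n : ℝ) + 1) ^ 2)⁻¹ * |∫ r in Ioc 0 (((n : ℝ) + 1) ^ 2), g r ω| ≤ (((n : ℝ) + 1) ^ 2)⁻¹ * (B * ((n : ℝ) + 1) ^ 2) :=
            mul_le_mul_of_nonneg_left h1 (inv_nonneg.2 (hTn n).le)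
        _ = B := by field_simp
    calc X n ω = |(((n : ℝ) + 1) ^ 2)⁻¹ * ∫ r in Ioc 0 (((n : ℝ) + 1) ^ 2), g r ω| ^ 2 := by rw [hX, sq_abs]
      _ ≤ B ^ 2 := pow_le_pow_left₀ (abs_nonneg _) h2 2
  have hXi : ∀ n, Integrable (X n) P := fun n =>
    (integrable_const (B ^ 2)).mono' (hXm n).aestronglyMeasurable
      (Eventually.of_forall fun ω => by rw [Real.norm_eq_abs, abs_of_nonneg (hX0 n ω)]; exact hXb n ω)
  have hEX : ∀ n, ∫ ω, X n ω ∂P ≤ K / (((n : ℝ) + 1) ^ 2) := fun n => hvar _ (hTn n)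
  -- `E Σ X_n < ∞`, hence `Σ X_n < ∞` a.s., hence `X_n → 0` a.s.
  have hsum : Summable fun n : ℕ => K / (((n : ℝ) + 1) ^ 2) := by
    have h := (summable_nat_add_iff 1).2 (Real.summable_one_div_nat_pow.2 one_lt_two)
    refine (h.mul_left K).congr fun n => ?_
    push_cast
    ring
  have hlin : ∫⁻ ω, (∑' n, ENNReal.ofReal (X n ω)) ∂P ≠ ∞ := by
    rw [lintegral_tsum fun n => (hXm n).ennreal_ofReal.aemeasurable]
    refine ne_top_of_le_ne_top (ENNReal.ofReal_ne_top (r := ∑' n : ℕ, K / (((n : ℝ) + 1) ^ 2))) ?_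
    rw [ENNReal.ofReal_tsum_of_nonneg (fun n => div_nonneg hK0 (hTn n).le) hsum]
    refine ENNReal.tsum_le_tsum fun n => ?_
    rw [← ofReal_integral_eq_lintegral_ofReal (hXi n) (ae_of_all _ (hX0 n))]
    exact ENNReal.ofReal_le_ofReal (hEX n)
  have hae : ∀ᵐ ω ∂P, Tendsto (fun n => X n ω) atTop (𝓝 0) := by
    have h1 := ae_lt_top (Measurable.tsum fun n => (hXm n).ennreal_ofReal) hlin
    filter_upwards [h1] with ω hω
    have h2 := ENNReal.tendsto_atTop_zero_of_tsum_ne_top hω.ne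
    have h3 : Tendsto (fun n => (ENNReal.ofReal (X n ω)).toReal) atTop (𝓝 (0 : ℝ≥0∞).toReal) :=
      (ENNReal.tendsto_toReal ENNReal.zero_ne_top).comp h2
    rw [ENNReal.toReal_zero] at h3
    exact h3.congr fun n => ENNReal.toReal_ofReal (hX0 n ω)
  -- interpolation between consecutive squares
  filter_upwards [hae] with ω hω
  -- `a m = m⁻² ∫_(0,m²] g → 0` along the integers (`a (n+1) = ±√(X n)`)
  set a : ℕ → ℝ := fun m => (((m : ℝ)) ^ 2)⁻¹ * ∫ r in Ioc 0 ((m : ℝ) ^ 2), g r ω with ha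
  have haX : ∀ n : ℕ, |a (n + 1)| = Real.sqrt (X n ω) := fun n => by
    rw [hX, ha]; push_cast; rw [Real.sqrt_sq_eq_abs]
  have ha0 : Tendsto (fun n : ℕ => a (n + 1)) atTop (𝓝 0) := by
    have h1 : Tendsto (fun n => Real.sqrt (X n ω)) atTop (𝓝 (Real.sqrt 0)) := (Real.continuous_sqrt.tendsto 0).comp hω
    rw [Real.sqrt_zero] at h1
    exact squeeze_zero_norm (fun n => by rw [Real.norm_eq_abs, haX n]) h1
  have ha0' : Tendsto a atTop (𝓝 0) := (tendsto_add_atTop_iff_nat 1).1 ha0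
  -- the error term `B(2m+1)/m²`
  have herr : Tendsto (fun m : ℕ => |B| * (2 * (m : ℝ) + 1) / (m : ℝ) ^ 2) atTop (𝓝 0) := by
    have h1 : Tendsto (fun m : ℕ => ((m : ℝ))⁻¹) atTop (𝓝 0) := tendsto_inv_atTop_nhds_zero_nat
    have h2 : Tendsto (fun m : ℕ => |B| * (2 * ((m : ℝ))⁻¹ + ((m : ℝ))⁻¹ * ((m : ℝ))⁻¹)) atTop (𝓝 (|B| * (2 * 0 + 0 * 0))) :=
      ((h1.const_mul 2).add (h1.mul h1)).const_mul |B|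
    rw [mul_zero, zero_mul, add_zero, mul_zero] at h2
    refine h2.congr' ?_
    filter_upwards [eventually_ge_atTop 1] with m hm
    have hm0 : (m : ℝ) ≠ 0 := by exact_mod_cast (Nat.one_le_iff_ne_zero.1 hm)
    field_simp
  have hφ : Tendsto (fun m : ℕ => |a m| + |B| * (2 * (m : ℝ) + 1) / (m : ℝ) ^ 2) atTop (𝓝 0) := by
    have h := (tendsto_zero_iff_norm_tendsto_zero.1 ha0').add herr
    rw [add_zero] at h
    simpa [Real.norm_eq_abs] using h
  have hfloor : Tendsto (fun T : ℝ => ⌊Real.sqrt T⌋₊) atTop atTop := tendsto_nat_floor_atTop.comp Real.tendsto_sqrt_atTop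
  refine squeeze_zero_norm' ?_ (hφ.comp hfloor)
  filter_upwards [eventually_ge_atTop (1 : ℝ)] with T hT
  -- `m = ⌊√T⌋`, `m² ≤ T < (m+1)²`, `m ≥ 1`
  set m : ℕ := ⌊Real.sqrt T⌋₊ with hm
  have hT0 : 0 < T := lt_of_lt_of_le one_pos hT
  have hsqT : Real.sqrt T ^ 2 = T := Real.sq_sqrt hT0.le
  have hm1 : 1 ≤ m := by
    rw [hm, Nat.one_le_floor_iff]; rw [← Real.sqrt_one]; exact Real.sqrt_le_sqrt hT
  have hmpos : (0 : ℝ) < (m : ℝ) := by exact_mod_cast hm1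
  have hm2le : ((m : ℝ)) ^ 2 ≤ T := by
    have h := Nat.floor_le (Real.sqrt_nonneg T)
    rw [← hm] at h
    calc ((m : ℝ)) ^ 2 ≤ Real.sqrt T ^ 2 := pow_le_pow_left₀ hmpos.le h 2
      _ = T := hsqT
  have hTlt : T < ((m : ℝ) + 1) ^ 2 := by
    have h := Nat.lt_floor_add_one (Real.sqrt T)
    rw [← hm] at h
    calc T = Real.sqrt T ^ 2 := hsqT.symm
      _ < ((m : ℝ) + 1) ^ 2 := pow_lt_pow_left₀ h (Real.sqrt_nonneg T) two_ne_zero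
  -- split the time integral at `m²`
  have hIO : ∀ S : Set ℝ, volume S < ∞ → IntegrableOn (fun r => g r ω) S volume := by
    intro S hS
    haveI : IsFiniteMeasure (volume.restrict S) := isFiniteMeasure_restrict.2 hS.ne
    exact (integrable_const B).mono' (hgr ω).aestronglyMeasurable
      (Eventually.of_forall fun r => by rw [Real.norm_eq_abs]; exact hB r ω)
  have hsplit : ∫ r in Ioc 0 T, g r ω = (∫ r in Ioc 0 (((m : ℝ)) ^ 2), g r ω) + ∫ r in Ioc (((m : ℝ)) ^ 2) T, g r ω := by
    rw [← setIntegral_union (Set.Ioc_disjoint_Ioc_of_le le_rfl) measurableSet_Ioc (hIO _ measure_Ioc_lt_top) (hIO _ measure_Ioc_lt_top),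
      Set.Ioc_union_Ioc_eq_Ioc (sq_nonneg _) hm2le]
  have hrest : |∫ r in Ioc (((m : ℝ)) ^ 2) T, g r ω| ≤ |B| * (2 * (m : ℝ) + 1) := by
    have h1 := hAb (S := Ioc (((m : ℝ)) ^ 2) T) ω measure_Ioc_lt_top
    rw [Real.volume_real_Ioc_of_le hm2le] at h1
    refine h1.trans ?_
    have hlen : T - ((m : ℝ)) ^ 2 ≤ 2 * (m : ℝ) + 1 := by nlinarith
    calc B * (T - ((m : ℝ)) ^ 2) ≤ |B| * (T - ((m : ℝ)) ^ 2) := mul_le_mul_of_nonneg_right (le_abs_self B) (by linarith)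
      _ ≤ |B| * (2 * (m : ℝ) + 1) := mul_le_mul_of_nonneg_left hlen (abs_nonneg B)
  have hm2pos : (0 : ℝ) < ((m : ℝ)) ^ 2 := by positivity
  have hTinv : T⁻¹ ≤ (((m : ℝ)) ^ 2)⁻¹ := by
    rw [inv_le_inv₀ hT0 hm2pos]; exact hm2le
  show ‖T⁻¹ * ∫ r in Ioc 0 T, g r ω‖ ≤ (fun m : ℕ => |a m| + |B| * (2 * (m : ℝ) + 1) / (m : ℝ) ^ 2) ⌊Real.sqrt T⌋₊
  rw [← hm, Real.norm_eq_abs, hsplit, mul_add, ha]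
  refine (abs_add_le _ _).trans (add_le_add ?_ ?_)
  · rw [abs_mul, abs_mul, abs_of_pos (inv_pos.2 hT0), abs_of_pos (inv_pos.2 hm2pos)]
    exact mul_le_mul_of_nonneg_right hTinv (abs_nonneg _)
  · rw [abs_mul, abs_of_pos (inv_pos.2 hT0), div_eq_inv_mul]
    exact mul_le_mul hTinv hrest (abs_nonneg _) (inv_nonneg.2 hm2pos.le)

/-! ## §2. The almost-sure ergodic theorem along every strong solution -/

variable {L : ℕ} [NeZero L]

/-- ★★★ **ALMOST-SURE ERGODIC THEOREM for the cold-start Langevin sampler** (every coupling, every start, every realisation): for every strong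
solution `U` of the SU(2) SZZ dynamics from a deterministic start on ANY probability space and every bounded measurable `G` with `|G| ≤ 1`,
`T⁻¹ ∫_(0,T] G(U_r) dr → ∫ G dμ_(β')` almost surely as `T → ∞`. [folklore] -/
theorem ae_tendsto_timeAverage_wilson (L : ℕ) [NeZero L] (β' : ℝ)
    (x : GaugeConfig 3 L (Matrix.specialUnitaryGroup (Fin 2) ℂ))
    {Ω : Type} [MeasurableSpace Ω] {P : Measure Ω} [IsProbabilityMeasure P]
    {W : ℝ≥0 → Ω → (Edge 3 L × NoiseIdx 2 → ℝ)} (hW : IsFlatBrownian W P)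
    {U : ℝ≥0 → Ω → GaugeConfig 3 L (Matrix.specialUnitaryGroup (Fin 2) ℂ)} (hU0 : ∀ ω, U 0 ω = x)
    (hU : (latticeLangevinDynamics (fundamentalLatticeRep 2) β').IsSolution (fundamentalRep (Fin 2)) hW.natFiltration P W U)
    {G : GaugeConfig 3 L (Matrix.specialUnitaryGroup (Fin 2) ℂ) → ℝ} (hG : Measurable G) (hG1 : ∀ z, |G z| ≤ 1) :
    ∀ᵐ ω ∂P, Tendsto (fun T : ℝ => T⁻¹ * ∫ r in Ioc 0 T, G (U r.toNNReal ω)) atTop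
      (𝓝 (∫ z, G z ∂(wilsonMeasure (d := 3) (L := L) (fundamentalRep (Fin 2)) β'))) := by
  classical
  haveI : IsProbabilityMeasure (wilsonMeasure (d := 3) (L := L) (fundamentalRep (Fin 2)) β') :=
    isProbabilityMeasure_wilsonMeasure (d := 3) (L := L) (fundamentalRep (Fin 2)) (continuous_fundamentalRep (Fin 2)) β'
  set m : ℝ := ∫ z, G z ∂(wilsonMeasure (d := 3) (L := L) (fundamentalRep (Fin 2)) β') with hm
  have hm1 : |m| ≤ 1 := by
    have hh := norm_integral_le_of_norm_le_const (μ := wilsonMeasure (d := 3) (L := L) (fundamentalRep (Fin 2)) β') (f := G) (C := 1)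
      (Eventually.of_forall fun z => by simpa [Real.norm_eq_abs] using hG1 z)
    simpa [Real.norm_eq_abs] using hh
  -- a jointly measurable realisation from the same start, indistinguishable from `U`
  obtain ⟨V, hV⟩ := exists_flow_measurable_uncurry L β' hW
  have hae := latticeLangevin_pathwise_unique hW β' x hU0 (hV x).1 hU (hV x).2.1
  obtain ⟨C, c, hC, hc, h49⟩ := integral_sq_timeAverage_sub_wilson_le L β'
  -- the centred field along `V x`
  set g : ℝ → Ω → ℝ := fun r ω => G (V x r.toNNReal ω) - m with hgdef
  have hgm : Measurable (Function.uncurry g) := by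
    have h1 : Measurable fun q : ℝ × Ω => V x q.1.toNNReal q.2 :=
      (hV x).2.2.comp ((measurable_real_toNNReal.comp measurable_fst).prodMk measurable_snd)
    exact (hG.comp h1).sub measurable_const
  have hgb : ∀ r ω, |g r ω| ≤ 2 := fun r ω => (abs_sub _ _).trans (by linarith [hG1 (V x r.toNNReal ω), hm1])
  haveI : ∀ T : ℝ, IsFiniteMeasure (volume.restrict (Ioc (0 : ℝ) T)) := fun T => isFiniteMeasure_restrict.2 measure_Ioc_lt_top.ne
  have hcent : ∀ (T : ℝ), 0 < T → ∀ ω, T⁻¹ * (∫ r in Ioc 0 T, G (V x r.toNNReal ω)) - m = T⁻¹ * ∫ r in Ioc 0 T, g r ω := by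
    intro T hT ω
    have hUr : Measurable fun r : ℝ => V x r.toNNReal ω := (hV x).2.2.comp (measurable_real_toNNReal.prodMk measurable_const)
    have hGi : Integrable (fun r : ℝ => G (V x r.toNNReal ω)) (volume.restrict (Ioc 0 T)) :=
      (integrable_const (1 : ℝ)).mono' (hG.comp hUr).aestronglyMeasurable
        (Eventually.of_forall fun r => by simpa [Real.norm_eq_abs] using hG1 (V x r.toNNReal ω))
    have hsub : ∫ r in Ioc 0 T, g r ω = (∫ r in Ioc 0 T, G (V x r.toNNReal ω)) - T * m := by
      show ∫ r in Ioc 0 T, (G (V x r.toNNReal ω) - m) = _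
      rw [integral_sub hGi (integrable_const m), integral_const, smul_eq_mul, measureReal_restrict_apply_univ,
        Real.volume_real_Ioc_of_le hT.le, sub_zero]
    rw [hsub, mul_sub, ← mul_assoc, inv_mul_cancel₀ hT.ne', one_mul]
  have hvar : ∀ T : ℝ, 0 < T → ∫ ω, (T⁻¹ * ∫ r in Ioc 0 T, g r ω) ^ 2 ∂P ≤ (4 * C / c) / T := by
    intro T hT
    have h := h49 x Ω P W hW (V x) (hV x).1 (hV x).2.1 (hV x).2.2 G hG hG1 T hT
    rw [div_div, show (4 : ℝ) * C / (c * T) = 4 * C / (c * T) from rfl]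
    refine le_of_eq_of_le (integral_congr_ae (ae_of_all _ fun ω => ?_)) h
    show (T⁻¹ * ∫ r in Ioc 0 T, g r ω) ^ 2 = (T⁻¹ * (∫ r in Ioc 0 T, G (V x r.toNNReal ω)) - m) ^ 2
    rw [hcent T hT ω]
  have hgen := ae_tendsto_timeAverage_zero_of_sq_le hgm hgb hvar
  filter_upwards [hgen, hae] with ω hω hωU
  -- back to `G` along `V x`, then along `U`
  have h1 : Tendsto (fun T : ℝ => T⁻¹ * (∫ r in Ioc 0 T, G (V x r.toNNReal ω)) - m) atTop (𝓝 0) := by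
    refine hω.congr' ?_
    filter_upwards [eventually_gt_atTop (0 : ℝ)] with T hT
    exact (hcent T hT ω).symm
  have h2 : Tendsto (fun T : ℝ => T⁻¹ * (∫ r in Ioc 0 T, G (V x r.toNNReal ω))) atTop (𝓝 m) := by
    have h := h1.add_const m
    simpa using h
  refine h2.congr fun T => ?_
  have hfun : (fun r : ℝ => G (V x r.toNNReal ω)) = fun r : ℝ => G (U r.toNNReal ω) := funext fun r => by rw [hωU]
  rw [hfun]

/-- ★★★ **Almost-sure ergodic theorem, general bounded observable** (scaling of `ae_tendsto_timeAverage_wilson`): for every bounded measurable `G`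
(`|G| ≤ C_G`) and every strong solution from a deterministic start on any space, `T⁻¹ ∫_(0,T] G(U_r) dr → ∫ G dμ_(β')` almost surely. [folklore] -/
theorem ae_tendsto_timeAverage_wilson_of_bounded (L : ℕ) [NeZero L] (β' : ℝ)
    (x : GaugeConfig 3 L (Matrix.specialUnitaryGroup (Fin 2) ℂ))
    {Ω : Type} [MeasurableSpace Ω] {P : Measure Ω} [IsProbabilityMeasure P]
    {W : ℝ≥0 → Ω → (Edge 3 L × NoiseIdx 2 → ℝ)} (hW : IsFlatBrownian W P)
    {U : ℝ≥0 → Ω → GaugeConfig 3 L (Matrix.specialUnitaryGroup (Fin 2) ℂ)} (hU0 : ∀ ω, U 0 ω = x)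
    (hU : (latticeLangevinDynamics (fundamentalLatticeRep 2) β').IsSolution (fundamentalRep (Fin 2)) hW.natFiltration P W U)
    {G : GaugeConfig 3 L (Matrix.specialUnitaryGroup (Fin 2) ℂ) → ℝ} (hG : Measurable G) {CG : ℝ} (hGb : ∀ z, |G z| ≤ CG) :
    ∀ᵐ ω ∂P, Tendsto (fun T : ℝ => T⁻¹ * ∫ r in Ioc 0 T, G (U r.toNNReal ω)) atTop
      (𝓝 (∫ z, G z ∂(wilsonMeasure (d := 3) (L := L) (fundamentalRep (Fin 2)) β'))) := by
  set C' : ℝ := max CG 1 with hC'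
  have hC'0 : 0 < C' := lt_of_lt_of_le one_pos (le_max_right _ _)
  have hG1 : ∀ z, |G z / C'| ≤ 1 := fun z => by
    rw [abs_div, abs_of_pos hC'0, div_le_one hC'0]
    exact (hGb z).trans (le_max_left _ _)
  have h := ae_tendsto_timeAverage_wilson L β' x hW hU0 hU (hG.div_const C') hG1
  filter_upwards [h] with ω hω
  have h2 := hω.const_mul C'
  have hscale : ∀ (μ : Measure (GaugeConfig 3 L (Matrix.specialUnitaryGroup (Fin 2) ℂ))), C' * ∫ z, G z / C' ∂μ = ∫ z, G z ∂μ := fun μ => by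
    rw [integral_div, mul_div_cancel₀ _ hC'0.ne']
  rw [hscale] at h2
  refine h2.congr fun T => ?_
  rw [integral_div]
  field_simp

/-! ## §3. A Chebyshev deviation bound for the time averages -/

/-- ★★ **Deviation bound for the cold-start time averages** (every coupling; `C, c` depend on `L, β'`): for every strong solution `U` from a
deterministic start on any space, every bounded measurable `G` with `|G| ≤ 1`, every `T > 0` and `ε > 0`,
`P(|T⁻¹∫_(0,T] G(U_r) dr − ∫ G dμ_(β')| ≥ ε) ≤ 4C/(c·T·ε²)` (Chebyshev on the mean-square ergodic theorem). [folklore] -/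
theorem measureReal_timeAverage_deviation_le (L : ℕ) [NeZero L] (β' : ℝ) :
    ∃ C c : ℝ, 0 < C ∧ 0 < c ∧
      ∀ (x : GaugeConfig 3 L (Matrix.specialUnitaryGroup (Fin 2) ℂ))
        (Ω : Type) [MeasurableSpace Ω] (P : Measure Ω) [IsProbabilityMeasure P]
        (W : ℝ≥0 → Ω → (Edge 3 L × NoiseIdx 2 → ℝ)) (hW : IsFlatBrownian W P)
        (U : ℝ≥0 → Ω → GaugeConfig 3 L (Matrix.specialUnitaryGroup (Fin 2) ℂ)),
        (∀ ω, U 0 ω = x) →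
        (latticeLangevinDynamics (fundamentalLatticeRep 2) β').IsSolution (fundamentalRep (Fin 2)) hW.natFiltration P W U →
        ∀ (G : GaugeConfig 3 L (Matrix.specialUnitaryGroup (Fin 2) ℂ) → ℝ), Measurable G → (∀ z, |G z| ≤ 1) →
        ∀ (T : ℝ), 0 < T → ∀ (ε : ℝ), 0 < ε →
          P.real {ω | ε ≤ |T⁻¹ * (∫ r in Ioc 0 T, G (U r.toNNReal ω)) - ∫ z, G z ∂(wilsonMeasure (d := 3) (L := L) (fundamentalRep (Fin 2)) β')|} ≤
            4 * C / (c * T * ε ^ 2) := by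
  classical
  obtain ⟨C, c, hC, hc, h⟩ := integral_sq_timeAverage_sub_wilson_le_of_solution L β'
  refine ⟨C, c, hC, hc, fun x Ω _ P _ W hW U hU0 hU G hG hG1 T hT ε hε => ?_⟩
  haveI : IsProbabilityMeasure (wilsonMeasure (d := 3) (L := L) (fundamentalRep (Fin 2)) β') :=
    isProbabilityMeasure_wilsonMeasure (d := 3) (L := L) (fundamentalRep (Fin 2)) (continuous_fundamentalRep (Fin 2)) β'
  set m : ℝ := ∫ z, G z ∂(wilsonMeasure (d := 3) (L := L) (fundamentalRep (Fin 2)) β') with hm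
  have hmain := h x Ω P W hW U hU0 hU G hG hG1 T hT
  -- measurability of the time average through a jointly measurable realisation
  obtain ⟨V, hV⟩ := exists_flow_measurable_uncurry L β' hW
  have hae := latticeLangevin_pathwise_unique hW β' x hU0 (hV x).1 hU (hV x).2.1
  have hAm : Measurable fun ω => ∫ r in Ioc 0 T, G (V x r.toNNReal ω) := by
    have h1 : Measurable fun q : ℝ × Ω => G (V x q.1.toNNReal q.2) :=
      hG.comp ((hV x).2.2.comp ((measurable_real_toNNReal.comp measurable_fst).prodMk measurable_snd))
    have h2 : StronglyMeasurable (Function.uncurry fun (ω : Ω) (r : ℝ) => G (V x r.toNNReal ω)) := (h1.comp measurable_swap).stronglyMeasurable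
    exact (h2.integral_prod_right (ν := volume.restrict (Ioc 0 T))).measurable
  set f : Ω → ℝ := fun ω => (T⁻¹ * (∫ r in Ioc 0 T, G (U r.toNNReal ω)) - m) ^ 2 with hf
  have hfV : f =ᵐ[P] fun ω => (T⁻¹ * (∫ r in Ioc 0 T, G (V x r.toNNReal ω)) - m) ^ 2 := by
    filter_upwards [hae] with ω hω
    have hfun : (fun r : ℝ => G (U r.toNNReal ω)) = fun r : ℝ => G (V x r.toNNReal ω) := funext fun r => by rw [hω]
    simp only [hf, hfun]
  -- `|time average| ≤ 1`, so `f ≤ 4`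
  haveI : IsFiniteMeasure (volume.restrict (Ioc (0 : ℝ) T)) := isFiniteMeasure_restrict.2 measure_Ioc_lt_top.ne
  have hm1 : |m| ≤ 1 := by
    have hh := norm_integral_le_of_norm_le_const (μ := wilsonMeasure (d := 3) (L := L) (fundamentalRep (Fin 2)) β') (f := G) (C := 1)
      (Eventually.of_forall fun z => by simpa [Real.norm_eq_abs] using hG1 z)
    simpa [Real.norm_eq_abs] using hh
  have havg : ∀ ω, |T⁻¹ * ∫ r in Ioc 0 T, G (V x r.toNNReal ω)| ≤ 1 := fun ω => by
    have hh := norm_setIntegral_le_of_norm_le_const (μ := volume) (s := Ioc 0 T) measure_Ioc_lt_top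
      (fun r _ => show ‖G (V x r.toNNReal ω)‖ ≤ 1 by rw [Real.norm_eq_abs]; exact hG1 _) (f := fun r => G (V x r.toNNReal ω))
    rw [Real.norm_eq_abs, Real.volume_real_Ioc_of_le hT.le, sub_zero] at hh
    rw [abs_mul, abs_inv, abs_of_pos hT]
    calc T⁻¹ * |∫ r in Ioc 0 T, G (V x r.toNNReal ω)| ≤ T⁻¹ * (1 * T) := mul_le_mul_of_nonneg_left hh (inv_nonneg.2 hT.le)
      _ = 1 := by field_simp
  have hfi : Integrable f P := by
    refine Integrable.congr ?_ hfV.symm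
    refine (integrable_const (4 : ℝ)).mono' (((hAm.const_mul _).sub_const m).pow_const 2).aestronglyMeasurable
      (Eventually.of_forall fun ω => ?_)
    rw [Real.norm_eq_abs, abs_pow, pow_two]
    have h3 : |T⁻¹ * (∫ r in Ioc 0 T, G (V x r.toNNReal ω)) - m| ≤ 2 := (abs_sub _ _).trans (by linarith [havg ω, hm1])
    nlinarith [abs_nonneg (T⁻¹ * (∫ r in Ioc 0 T, G (V x r.toNNReal ω)) - m)]
  -- Chebyshev
  have hmarkov := mul_meas_ge_le_integral_of_nonneg (μ := P) (f := f) (ae_of_all _ fun ω => sq_nonneg _) hfi (ε ^ 2)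
  have hsub : {ω | ε ≤ |T⁻¹ * (∫ r in Ioc 0 T, G (U r.toNNReal ω)) - m|} ⊆ {ω | ε ^ 2 ≤ f ω} := by
    intro ω hω
    simp only [Set.mem_setOf_eq] at hω ⊢
    rw [hf]
    calc ε ^ 2 ≤ |T⁻¹ * (∫ r in Ioc 0 T, G (U r.toNNReal ω)) - m| ^ 2 := pow_le_pow_left₀ hε.le hω 2
      _ = _ := sq_abs _
  have hε2 : 0 < ε ^ 2 := by positivity
  calc P.real {ω | ε ≤ |T⁻¹ * (∫ r in Ioc 0 T, G (U r.toNNReal ω)) - m|} ≤ P.real {ω | ε ^ 2 ≤ f ω} := measureReal_mono hsub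
    _ ≤ (∫ ω, f ω ∂P) / ε ^ 2 := by rw [le_div_iff₀ hε2, mul_comm]; exact hmarkov
    _ ≤ (4 * C / (c * T)) / ε ^ 2 := div_le_div_of_nonneg_right hmain hε2.le
    _ = 4 * C / (c * T * ε ^ 2) := by rw [div_div]

end Summit.QuantumFields.YangMills.Theorems.ColdStartUniversality.LiebRobinson

end
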